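import Literature.Topology.FourManifolds.CappellShanesonClassGroupFortysix
import Literature.Topology.FourManifolds.CappellShanesonClassGroupFortysixCls
import Literature.Topology.FourManifolds.CappellShanesonTotallyReal
import Literature.Topology.FourManifolds.CappellShanesonClassGroupTwelve
import Literature.Topology.FourManifolds.CappellShanesonClassGroupFifteen
import HarnessLib

/-!
# Trace `46`: the class group, the cover of `C(ℤ[Θ₄₆])`, Gompf's conjecture for the traces `46` and `-41`

Part 'Main' of the certified class-group computation for the trace `46` field behind
Kim–Yamada's Theorem B (`GompfConjectureForTrace 46` and, by Theorem A, `-41`), serving the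
named fact
`Literature.Topology.FourManifolds.kimYamada2023_nonempty_diffeomorph_sphere_four_of_trace_mem_Icc`
(`CappellShaneson.lean`; M. H. Kim, S. Yamada, Kyungpook Math. J. 63 (2023) 373–411 =
arXiv:1707.03860, Cor. C). The computation is split over several files only because of the
proposal size limit: `…ClassGroupFortysix.lean` (discriminant, `𝓞 K = ℤ[θ]`, the primes of small norm), `…ClassGroupFortysixRel<k>.lean` (two-ideal relations with certified generators and the non-vanishing of the generators), `…ClassGroupFortysixCls.lean` (the class of every small prime in terms of the generator(s), the order relations), `…ClassGroupFortysixMain.lean` (generation of the class group by Minkowski's bound, the cover of `C(ℤ[Θ])` by standard-matrix representatives, Gompf's conjecture for the two traces). (File generated from a certified computation; every relation is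
checked by the Lean kernel; no named fact is introduced, D-0026.)

## References

* [KimYamada2023] M. H. Kim, S. Yamada, Kyungpook Math. J. 63 (2023) 373–411 (arXiv:1707.03860):
  §2.3 (Prop. 2.14), §6.1 (Lemma 6.1 and the proof of Thm. B), Thm. A.
* [Marcus2018] D. A. Marcus, *Number Fields*, 2nd ed., Ch. 3, Thm. 27 (Dedekind–Kummer); Ch. 5,
  Cor. 2 of Thm. 37 (Minkowski bound) and the class-group computations after it.
-/

noncomputable section

open Set Polynomial Module NumberField Ideal
open scoped NumberField MatrixGroups nonZeroDivisors
open Literature.LinearAlgebra.Matrix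

namespace Literature.Topology.FourManifolds

section Field

variable {K : Type*} [Field K] [NumberField K] {θ : K}

set_option maxHeartbeats 2000000 in
/-- **Every ideal class of the trace `46` field is a power `aʳ`, `0 ≤ r < 12`, of `a = [(19, θ - 14)]`,
represented by the ideals listed** (so the class number divides `12`). Proof: `d_K = 3568289`,
`⌊M_K⌋ ≤ 419`, Dedekind–Kummer at `p ≤ 419`, and the class of every small prime computed above
from two-ideal relations with certified generators. [cite: KimYamada2023, §6.1 (proof of Thm. B)] -/
theorem classGroup_mem_fortysix (hθ : aeval θ (csPoly 46) = 0) (h3 : finrank ℚ K = 3)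
    (C : ClassGroup (𝓞 K)) :
    C = 1 ∨
      C = ClassGroup.mk0 ⟨span {(19 : 𝓞 K), thetaInt hθ - 14}, (span_pair_ofNat_mem_nonZeroDivisors (nat_lit 19) (thetaInt hθ - 14))⟩ ∨
      C = ClassGroup.mk0 ⟨span {(11 : 𝓞 K), thetaInt hθ - 3}, (span_pair_ofNat_mem_nonZeroDivisors (nat_lit 11) (thetaInt hθ - 3))⟩ ∨
      C = ClassGroup.mk0 ⟨span {(3 : 𝓞 K), thetaInt hθ - 2}, (span_pair_ofNat_mem_nonZeroDivisors (nat_lit 3) (thetaInt hθ - 2))⟩ ∨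
      C = ClassGroup.mk0 ⟨span {(29 : 𝓞 K), thetaInt hθ - 4}, (span_pair_ofNat_mem_nonZeroDivisors (nat_lit 29) (thetaInt hθ - 4))⟩ ∨
      C = ClassGroup.mk0 ⟨span {(67 : 𝓞 K), thetaInt hθ - 48}, (span_pair_ofNat_mem_nonZeroDivisors (nat_lit 67) (thetaInt hθ - 48))⟩ ∨
      C = ClassGroup.mk0 ⟨span {(9 : 𝓞 K), thetaInt hθ - 5}, (span_pair_ofNat_mem_nonZeroDivisors (nat_lit 9) (thetaInt hθ - 5))⟩ ∨
      C = ClassGroup.mk0 ⟨span {(23 : 𝓞 K), thetaInt hθ - 10}, (span_pair_ofNat_mem_nonZeroDivisors (nat_lit 23) (thetaInt hθ - 10))⟩ ∨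
      C = ClassGroup.mk0 ⟨span {(17 : 𝓞 K), thetaInt hθ - 4}, (span_pair_ofNat_mem_nonZeroDivisors (nat_lit 17) (thetaInt hθ - 4))⟩ ∨
      C = ClassGroup.mk0 ⟨span {(31 : 𝓞 K), thetaInt hθ - 30}, (span_pair_ofNat_mem_nonZeroDivisors (nat_lit 31) (thetaInt hθ - 30))⟩ ∨
      C = ClassGroup.mk0 ⟨span {(23 : 𝓞 K), thetaInt hθ - 3}, (span_pair_ofNat_mem_nonZeroDivisors (nat_lit 23) (thetaInt hθ - 3))⟩ ∨
      C = ClassGroup.mk0 ⟨span {(51 : 𝓞 K), thetaInt hθ - 38}, (span_pair_ofNat_mem_nonZeroDivisors (nat_lit 51) (thetaInt hθ - 38))⟩ := by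
  classical
  obtain ⟨a, ha⟩ : ∃ a : ClassGroup (𝓞 K), ClassGroup.mk0 ⟨span {(19 : 𝓞 K), thetaInt hθ - 14}, (span_pair_ofNat_mem_nonZeroDivisors (nat_lit 19) (thetaInt hθ - 14))⟩ = a := ⟨_, rfl⟩
  have ham : a ^ (12 : ℤ) = 1 := by rw [← ha]; exact pow_order_fortysix hθ
  let H : Subgroup (ClassGroup (𝓞 K)) := Subgroup.zpowers a
  have hprinc : ∀ (P : Ideal (𝓞 K)) (hP0 : P ∈ (Ideal (𝓞 K))⁰) (x : 𝓞 K), P = span {x} →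
      ClassGroup.mk0 ⟨P, hP0⟩ ∈ H := by
    intro P hP0 x hPx
    have : ClassGroup.mk0 ⟨P, hP0⟩ = 1 :=
      (ClassGroup.mk0_eq_one_iff hP0).mpr ⟨⟨x, by rw [hPx, submodule_span_eq]⟩⟩
    rw [this]
    exact H.one_mem
  -- Minkowski: `⌊M_K⌋ ≤ 419`
  have hd : ((|NumberField.discr K| : ℤ) : ℝ) ≤ (3568289 : ℕ) := by
    rw [discr_eq_fortysix hθ h3]
    norm_num
  have hfloor := floor_minkowskiBound_le_cubic_real h3 (nrComplexPlaces_eq_zero_of_csPoly hθ h3 (by norm_num))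
    hd (s := 1889) (U := 419) (by norm_num) (by norm_num) (by norm_num)
  have htop : H = ⊤ := by
    refine classGroup_subgroup_eq_top_of_primesOver H hfloor fun p hp hprime P hP0 hP hle => ?_
    have hpU : p ≤ 419 := (Finset.mem_Icc.mp hp).2
    have h1p : 1 ≤ p := (Finset.mem_Icc.mp hp).1
    interval_cases p
    · exact absurd hprime (by norm_num)
    · exact hprinc P hP0 _ (eq_span_of_inert_fortysix hθ h3 (by norm_num) hP)
    · -- `p = 3`
      rcases eq_P3_or_eq_Q3_fortysix hθ h3 hP with h | h <;> subst h
      · exact mem_zpowers_of_mk0_eq a (cls_P3_2_fortysix hθ) ha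
      · exact mem_zpowers_of_mk0_eq a (cls_Q3_fortysix hθ) ha
    · exact absurd hprime (by norm_num)
    · exact hprinc P hP0 _ (eq_span_of_inert_fortysix hθ h3 (by norm_num) hP)
    · exact absurd hprime (by norm_num)
    · exact hprinc P hP0 _ (eq_span_of_inert_fortysix hθ h3 (by norm_num) hP)
    · exact absurd hprime (by norm_num)
    · exact absurd hprime (by norm_num)
    · exact absurd hprime (by norm_num)
    · -- `p = 11`
      rcases eq_P11_or_eq_Q11_fortysix hθ h3 hP with h | h <;> subst h
      · exact mem_zpowers_of_mk0_eq a (cls_P11_3_fortysix hθ) ha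
      · exact mem_zpowers_of_mk0_eq a (cls_Q11_fortysix hθ) ha
    · exact absurd hprime (by norm_num)
    · exact hprinc P hP0 _ (eq_span_of_inert_fortysix hθ h3 (by norm_num) hP)
    · exact absurd hprime (by norm_num)
    · exact absurd hprime (by norm_num)
    · exact absurd hprime (by norm_num)
    · -- `p = 17`
      rcases eq_P17_or_eq_Q17_fortysix hθ h3 hP with h | h <;> subst h
      · exact mem_zpowers_of_mk0_eq a (cls_P17_4_fortysix hθ) ha
      · exact mem_zpowers_of_mk0_eq a (cls_Q17_fortysix hθ) ha
    · exact absurd hprime (by norm_num)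
    · -- `p = 19`
      rcases eq_P19_or_eq_Q19_fortysix hθ h3 hP with h | h <;> subst h
      · rw [show ClassGroup.mk0 ⟨_, hP0⟩ = ClassGroup.mk0 ⟨span {(19 : 𝓞 K), thetaInt hθ - 14}, (span_pair_ofNat_mem_nonZeroDivisors (nat_lit 19) (thetaInt hθ - 14))⟩ from rfl, ha]
        exact Subgroup.mem_zpowers a
      · exact mem_zpowers_of_mk0_eq a (cls_Q19_fortysix hθ) ha
    · exact absurd hprime (by norm_num)
    · exact absurd hprime (by norm_num)
    · exact absurd hprime (by norm_num)
    · -- `p = 23` (ramified)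
      rcases eq_P23_fortysix hθ h3 hP with h | h | h <;> subst h
      · exact mem_zpowers_of_mk0_eq a (cls_P23_3_fortysix hθ) ha
      · exact mem_zpowers_of_mk0_eq a (cls_P23_10_fortysix hθ) ha
      · exact mem_zpowers_of_mk0_eq a (cls_P23_10_fortysix hθ) ha
    · exact absurd hprime (by norm_num)
    · exact absurd hprime (by norm_num)
    · exact absurd hprime (by norm_num)
    · exact absurd hprime (by norm_num)
    · exact absurd hprime (by norm_num)
    · -- `p = 29` (splits)
      rcases eq_P29_fortysix hθ h3 hP with h | h | h <;> subst h
      · exact mem_zpowers_of_mk0_eq a (cls_P29_2_fortysix hθ) ha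
      · exact mem_zpowers_of_mk0_eq a (cls_P29_4_fortysix hθ) ha
      · exact mem_zpowers_of_mk0_eq a (cls_P29_11_fortysix hθ) ha
    · exact absurd hprime (by norm_num)
    · -- `p = 31`
      have h := eq_span_pair_of_unique_root_fortysix hθ h3 (Or.inl ⟨rfl, rfl⟩) hP hle
      simp only [Nat.cast_ofNat, Int.cast_ofNat] at h
      subst h
      exact mem_zpowers_of_mk0_eq a (cls_P31_30_fortysix hθ) ha
    · exact absurd hprime (by norm_num)
    · exact absurd hprime (by norm_num)
    · exact absurd hprime (by norm_num)
    · exact absurd hprime (by norm_num)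
    · exact absurd hprime (by norm_num)
    · exact hprinc P hP0 _ (eq_span_of_inert_fortysix hθ h3 (by norm_num) hP)
    · exact absurd hprime (by norm_num)
    · exact absurd hprime (by norm_num)
    · exact absurd hprime (by norm_num)
    · exact hprinc P hP0 _ (eq_span_of_inert_fortysix hθ h3 (by norm_num) hP)
    · exact absurd hprime (by norm_num)
    · -- `p = 43`
      have h := eq_span_pair_of_unique_root_fortysix hθ h3 (Or.inr (Or.inl ⟨rfl, rfl⟩)) hP hle
      simp only [Nat.cast_ofNat, Int.cast_ofNat] at h
      subst h
      exact mem_zpowers_of_mk0_eq a (cls_P43_11_fortysix hθ) ha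
    · exact absurd hprime (by norm_num)
    · exact absurd hprime (by norm_num)
    · exact absurd hprime (by norm_num)
    · exact hprinc P hP0 _ (eq_span_of_inert_fortysix hθ h3 (by norm_num) hP)
    · exact absurd hprime (by norm_num)
    · exact absurd hprime (by norm_num)
    · exact absurd hprime (by norm_num)
    · exact absurd hprime (by norm_num)
    · exact absurd hprime (by norm_num)
    · exact hprinc P hP0 _ (eq_span_of_inert_fortysix hθ h3 (by norm_num) hP)
    · exact absurd hprime (by norm_num)
    · exact absurd hprime (by norm_num)
    · exact absurd hprime (by norm_num)
    · exact absurd hprime (by norm_num)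
    · exact absurd hprime (by norm_num)
    · exact hprinc P hP0 _ (eq_span_of_inert_fortysix hθ h3 (by norm_num) hP)
    · exact absurd hprime (by norm_num)
    · -- `p = 61`
      have h := eq_span_pair_of_unique_root_fortysix hθ h3 (Or.inr (Or.inr (Or.inl ⟨rfl, rfl⟩))) hP hle
      simp only [Nat.cast_ofNat, Int.cast_ofNat] at h
      subst h
      exact mem_zpowers_of_mk0_eq a (cls_P61_29_fortysix hθ) ha
    · exact absurd hprime (by norm_num)
    · exact absurd hprime (by norm_num)
    · exact absurd hprime (by norm_num)
    · exact absurd hprime (by norm_num)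
    · exact absurd hprime (by norm_num)
    · -- `p = 67`
      have h := eq_span_pair_of_unique_root_fortysix hθ h3 (Or.inr (Or.inr (Or.inr (Or.inl ⟨rfl, rfl⟩)))) hP hle
      simp only [Nat.cast_ofNat, Int.cast_ofNat] at h
      subst h
      exact mem_zpowers_of_mk0_eq a (cls_P67_48_fortysix hθ) ha
    · exact absurd hprime (by norm_num)
    · exact absurd hprime (by norm_num)
    · exact absurd hprime (by norm_num)
    · -- `p = 71`
      have h := eq_span_pair_of_unique_root_fortysix hθ h3 (Or.inr (Or.inr (Or.inr (Or.inr (Or.inl ⟨rfl, rfl⟩))))) hP hle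
      simp only [Nat.cast_ofNat, Int.cast_ofNat] at h
      subst h
      exact mem_zpowers_of_mk0_eq a (cls_P71_29_fortysix hθ) ha
    · exact absurd hprime (by norm_num)
    · exact hprinc P hP0 _ (eq_span_of_inert_fortysix hθ h3 (by norm_num) hP)
    · exact absurd hprime (by norm_num)
    · exact absurd hprime (by norm_num)
    · exact absurd hprime (by norm_num)
    · exact absurd hprime (by norm_num)
    · exact absurd hprime (by norm_num)
    · -- `p = 79`
      have h := eq_span_pair_of_unique_root_fortysix hθ h3 (Or.inr (Or.inr (Or.inr (Or.inr (Or.inr (Or.inl ⟨rfl, rfl⟩)))))) hP hle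
      simp only [Nat.cast_ofNat, Int.cast_ofNat] at h
      subst h
      exact mem_zpowers_of_mk0_eq a (cls_P79_74_fortysix hθ) ha
    · exact absurd hprime (by norm_num)
    · exact absurd hprime (by norm_num)
    · exact absurd hprime (by norm_num)
    · exact hprinc P hP0 _ (eq_span_of_inert_fortysix hθ h3 (by norm_num) hP)
    · exact absurd hprime (by norm_num)
    · exact absurd hprime (by norm_num)
    · exact absurd hprime (by norm_num)
    · exact absurd hprime (by norm_num)
    · exact absurd hprime (by norm_num)
    · -- `p = 89`
      have h := eq_span_pair_of_unique_root_fortysix hθ h3 (Or.inr (Or.inr (Or.inr (Or.inr (Or.inr (Or.inr (Or.inl ⟨rfl, rfl⟩))))))) hP hle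
      simp only [Nat.cast_ofNat, Int.cast_ofNat] at h
      subst h
      exact mem_zpowers_of_mk0_eq a (cls_P89_5_fortysix hθ) ha
    · exact absurd hprime (by norm_num)
    · exact absurd hprime (by norm_num)
    · exact absurd hprime (by norm_num)
    · exact absurd hprime (by norm_num)
    · exact absurd hprime (by norm_num)
    · exact absurd hprime (by norm_num)
    · exact absurd hprime (by norm_num)
    · exact hprinc P hP0 _ (eq_span_of_inert_fortysix hθ h3 (by norm_num) hP)
    · exact absurd hprime (by norm_num)
    · exact absurd hprime (by norm_num)
    · exact absurd hprime (by norm_num)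
    · -- `p = 101`
      have h := eq_span_pair_of_unique_root_fortysix hθ h3 (Or.inr (Or.inr (Or.inr (Or.inr (Or.inr (Or.inr (Or.inr (Or.inl ⟨rfl, rfl⟩)))))))) hP hle
      simp only [Nat.cast_ofNat, Int.cast_ofNat] at h
      subst h
      exact mem_zpowers_of_mk0_eq a (cls_P101_48_fortysix hθ) ha
    · exact absurd hprime (by norm_num)
    · exact hprinc P hP0 _ (eq_span_of_inert_fortysix hθ h3 (by norm_num) hP)
    · exact absurd hprime (by norm_num)
    · exact absurd hprime (by norm_num)
    · exact absurd hprime (by norm_num)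
    · exact hprinc P hP0 _ (eq_span_of_inert_fortysix hθ h3 (by norm_num) hP)
    · exact absurd hprime (by norm_num)
    · -- `p = 109`
      have h := eq_span_pair_of_unique_root_fortysix hθ h3 (Or.inr (Or.inr (Or.inr (Or.inr (Or.inr (Or.inr (Or.inr (Or.inr (Or.inl ⟨rfl, rfl⟩))))))))) hP hle
      simp only [Nat.cast_ofNat, Int.cast_ofNat] at h
      subst h
      exact mem_zpowers_of_mk0_eq a (cls_P109_105_fortysix hθ) ha
    · exact absurd hprime (by norm_num)
    · exact absurd hprime (by norm_num)
    · exact absurd hprime (by norm_num)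
    · exact hprinc P hP0 _ (eq_span_of_inert_fortysix hθ h3 (by norm_num) hP)
    · exact absurd hprime (by norm_num)
    · exact absurd hprime (by norm_num)
    · exact absurd hprime (by norm_num)
    · exact absurd hprime (by norm_num)
    · exact absurd hprime (by norm_num)
    · exact absurd hprime (by norm_num)
    · exact absurd hprime (by norm_num)
    · exact absurd hprime (by norm_num)
    · exact absurd hprime (by norm_num)
    · exact absurd hprime (by norm_num)
    · exact absurd hprime (by norm_num)
    · exact absurd hprime (by norm_num)
    · exact absurd hprime (by norm_num)
    · -- `p = 127`
      have h := eq_span_pair_of_unique_root_fortysix hθ h3 (Or.inr (Or.inr (Or.inr (Or.inr (Or.inr (Or.inr (Or.inr (Or.inr (Or.inr (Or.inl ⟨rfl, rfl⟩)))))))))) hP hle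
      simp only [Nat.cast_ofNat, Int.cast_ofNat] at h
      subst h
      exact mem_zpowers_of_mk0_eq a (cls_P127_84_fortysix hθ) ha
    · exact absurd hprime (by norm_num)
    · exact absurd hprime (by norm_num)
    · exact absurd hprime (by norm_num)
    · -- `p = 131`
      have h := eq_span_pair_of_unique_root_fortysix hθ h3 (Or.inr (Or.inr (Or.inr (Or.inr (Or.inr (Or.inr (Or.inr (Or.inr (Or.inr (Or.inr (Or.inl ⟨rfl, rfl⟩))))))))))) hP hle
      simp only [Nat.cast_ofNat, Int.cast_ofNat] at h
      subst h
      exact mem_zpowers_of_mk0_eq a (cls_P131_47_fortysix hθ) ha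
    · exact absurd hprime (by norm_num)
    · exact absurd hprime (by norm_num)
    · exact absurd hprime (by norm_num)
    · exact absurd hprime (by norm_num)
    · exact absurd hprime (by norm_num)
    · -- `p = 137`
      have h := eq_span_pair_of_unique_root_fortysix hθ h3 (Or.inr (Or.inr (Or.inr (Or.inr (Or.inr (Or.inr (Or.inr (Or.inr (Or.inr (Or.inr (Or.inr (Or.inl ⟨rfl, rfl⟩)))))))))))) hP hle
      simp only [Nat.cast_ofNat, Int.cast_ofNat] at h
      subst h
      exact mem_zpowers_of_mk0_eq a (cls_P137_10_fortysix hθ) ha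
    · exact absurd hprime (by norm_num)
    · exact hprinc P hP0 _ (eq_span_of_inert_fortysix hθ h3 (by norm_num) hP)
    · exact absurd hprime (by norm_num)
    · exact absurd hprime (by norm_num)
    · exact absurd hprime (by norm_num)
    · exact absurd hprime (by norm_num)
    · exact absurd hprime (by norm_num)
    · exact absurd hprime (by norm_num)
    · exact absurd hprime (by norm_num)
    · exact absurd hprime (by norm_num)
    · exact absurd hprime (by norm_num)
    · exact hprinc P hP0 _ (eq_span_of_inert_fortysix hθ h3 (by norm_num) hP)
    · exact absurd hprime (by norm_num)
    · exact hprinc P hP0 _ (eq_span_of_inert_fortysix hθ h3 (by norm_num) hP)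
    · exact absurd hprime (by norm_num)
    · exact absurd hprime (by norm_num)
    · exact absurd hprime (by norm_num)
    · exact absurd hprime (by norm_num)
    · exact absurd hprime (by norm_num)
    · -- `p = 157`
      have h := eq_span_pair_of_unique_root_fortysix hθ h3 (Or.inr (Or.inr (Or.inr (Or.inr (Or.inr (Or.inr (Or.inr (Or.inr (Or.inr (Or.inr (Or.inr (Or.inr (Or.inl ⟨rfl, rfl⟩))))))))))))) hP hle
      simp only [Nat.cast_ofNat, Int.cast_ofNat] at h
      subst h
      exact mem_zpowers_of_mk0_eq a (cls_P157_107_fortysix hθ) ha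
    · exact absurd hprime (by norm_num)
    · exact absurd hprime (by norm_num)
    · exact absurd hprime (by norm_num)
    · exact absurd hprime (by norm_num)
    · exact absurd hprime (by norm_num)
    · exact hprinc P hP0 _ (eq_span_of_inert_fortysix hθ h3 (by norm_num) hP)
    · exact absurd hprime (by norm_num)
    · exact absurd hprime (by norm_num)
    · exact absurd hprime (by norm_num)
    · -- `p = 167` (ramified)
      rcases eq_P167_fortysix hθ h3 hP with h | h | h <;> subst h
      · exact mem_zpowers_of_mk0_eq a (cls_P167_63_fortysix hθ) ha
      · exact mem_zpowers_of_mk0_eq a (cls_P167_75_fortysix hθ) ha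
      · exact mem_zpowers_of_mk0_eq a (cls_P167_75_fortysix hθ) ha
    · exact absurd hprime (by norm_num)
    · exact absurd hprime (by norm_num)
    · exact absurd hprime (by norm_num)
    · exact absurd hprime (by norm_num)
    · exact absurd hprime (by norm_num)
    · exact hprinc P hP0 _ (eq_span_of_inert_fortysix hθ h3 (by norm_num) hP)
    · exact absurd hprime (by norm_num)
    · exact absurd hprime (by norm_num)
    · exact absurd hprime (by norm_num)
    · exact absurd hprime (by norm_num)
    · exact absurd hprime (by norm_num)
    · -- `p = 179`
      have h := eq_span_pair_of_unique_root_fortysix hθ h3 (Or.inr (Or.inr (Or.inr (Or.inr (Or.inr (Or.inr (Or.inr (Or.inr (Or.inr (Or.inr (Or.inr (Or.inr (Or.inr (Or.inl ⟨rfl, rfl⟩)))))))))))))) hP hle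
      simp only [Nat.cast_ofNat, Int.cast_ofNat] at h
      subst h
      exact mem_zpowers_of_mk0_eq a (cls_P179_26_fortysix hθ) ha
    · exact absurd hprime (by norm_num)
    · exact hprinc P hP0 _ (eq_span_of_inert_fortysix hθ h3 (by norm_num) hP)
    · exact absurd hprime (by norm_num)
    · exact absurd hprime (by norm_num)
    · exact absurd hprime (by norm_num)
    · exact absurd hprime (by norm_num)
    · exact absurd hprime (by norm_num)
    · exact absurd hprime (by norm_num)
    · exact absurd hprime (by norm_num)
    · exact absurd hprime (by norm_num)
    · exact absurd hprime (by norm_num)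
    · exact hprinc P hP0 _ (eq_span_of_inert_fortysix hθ h3 (by norm_num) hP)
    · exact absurd hprime (by norm_num)
    · -- `p = 193`
      have h := eq_span_pair_of_unique_root_fortysix hθ h3 (Or.inr (Or.inr (Or.inr (Or.inr (Or.inr (Or.inr (Or.inr (Or.inr (Or.inr (Or.inr (Or.inr (Or.inr (Or.inr (Or.inr (Or.inl ⟨rfl, rfl⟩))))))))))))))) hP hle
      simp only [Nat.cast_ofNat, Int.cast_ofNat] at h
      subst h
      exact mem_zpowers_of_mk0_eq a (cls_P193_38_fortysix hθ) ha
    · exact absurd hprime (by norm_num)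
    · exact absurd hprime (by norm_num)
    · exact absurd hprime (by norm_num)
    · exact hprinc P hP0 _ (eq_span_of_inert_fortysix hθ h3 (by norm_num) hP)
    · exact absurd hprime (by norm_num)
    · exact hprinc P hP0 _ (eq_span_of_inert_fortysix hθ h3 (by norm_num) hP)
    · exact absurd hprime (by norm_num)
    · exact absurd hprime (by norm_num)
    · exact absurd hprime (by norm_num)
    · exact absurd hprime (by norm_num)
    · exact absurd hprime (by norm_num)
    · exact absurd hprime (by norm_num)
    · exact absurd hprime (by norm_num)
    · exact absurd hprime (by norm_num)
    · exact absurd hprime (by norm_num)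
    · exact absurd hprime (by norm_num)
    · exact absurd hprime (by norm_num)
    · -- `p = 211`
      have h := eq_span_pair_of_unique_root_fortysix hθ h3 (Or.inr (Or.inr (Or.inr (Or.inr (Or.inr (Or.inr (Or.inr (Or.inr (Or.inr (Or.inr (Or.inr (Or.inr (Or.inr (Or.inr (Or.inr (Or.inl ⟨rfl, rfl⟩)))))))))))))))) hP hle
      simp only [Nat.cast_ofNat, Int.cast_ofNat] at h
      subst h
      exact mem_zpowers_of_mk0_eq a (cls_P211_102_fortysix hθ) ha
    · exact absurd hprime (by norm_num)
    · exact absurd hprime (by norm_num)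
    · exact absurd hprime (by norm_num)
    · exact absurd hprime (by norm_num)
    · exact absurd hprime (by norm_num)
    · exact absurd hprime (by norm_num)
    · exact absurd hprime (by norm_num)
    · exact absurd hprime (by norm_num)
    · exact absurd hprime (by norm_num)
    · exact absurd hprime (by norm_num)
    · exact absurd hprime (by norm_num)
    · exact hprinc P hP0 _ (eq_span_of_inert_fortysix hθ h3 (by norm_num) hP)
    · exact absurd hprime (by norm_num)
    · exact absurd hprime (by norm_num)
    · exact absurd hprime (by norm_num)
    · exact hprinc P hP0 _ (eq_span_of_inert_fortysix hθ h3 (by norm_num) hP)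
    · exact absurd hprime (by norm_num)
    · exact hprinc P hP0 _ (eq_span_of_inert_fortysix hθ h3 (by norm_num) hP)
    · exact absurd hprime (by norm_num)
    · exact absurd hprime (by norm_num)
    · exact absurd hprime (by norm_num)
    · -- `p = 233`
      have h := eq_span_pair_of_unique_root_fortysix hθ h3 (Or.inr (Or.inr (Or.inr (Or.inr (Or.inr (Or.inr (Or.inr (Or.inr (Or.inr (Or.inr (Or.inr (Or.inr (Or.inr (Or.inr (Or.inr (Or.inr (Or.inl ⟨rfl, rfl⟩))))))))))))))))) hP hle
      simp only [Nat.cast_ofNat, Int.cast_ofNat] at h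
      subst h
      exact mem_zpowers_of_mk0_eq a (cls_P233_89_fortysix hθ) ha
    · exact absurd hprime (by norm_num)
    · exact absurd hprime (by norm_num)
    · exact absurd hprime (by norm_num)
    · exact absurd hprime (by norm_num)
    · exact absurd hprime (by norm_num)
    · -- `p = 239`
      have h := eq_span_pair_of_unique_root_fortysix hθ h3 (Or.inr (Or.inr (Or.inr (Or.inr (Or.inr (Or.inr (Or.inr (Or.inr (Or.inr (Or.inr (Or.inr (Or.inr (Or.inr (Or.inr (Or.inr (Or.inr (Or.inr (Or.inl ⟨rfl, rfl⟩)))))))))))))))))) hP hle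
      simp only [Nat.cast_ofNat, Int.cast_ofNat] at h
      subst h
      exact hprinc _ hP0 _ (P239_160_eq_fortysix hθ)
    · exact absurd hprime (by norm_num)
    · -- `p = 241`
      have h := eq_span_pair_of_unique_root_fortysix hθ h3 (Or.inr (Or.inr (Or.inr (Or.inr (Or.inr (Or.inr (Or.inr (Or.inr (Or.inr (Or.inr (Or.inr (Or.inr (Or.inr (Or.inr (Or.inr (Or.inr (Or.inr (Or.inr (Or.inl ⟨rfl, rfl⟩))))))))))))))))))) hP hle
      simp only [Nat.cast_ofNat, Int.cast_ofNat] at h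
      subst h
      exact hprinc _ hP0 _ (P241_161_eq_fortysix hθ)
    · exact absurd hprime (by norm_num)
    · exact absurd hprime (by norm_num)
    · exact absurd hprime (by norm_num)
    · exact absurd hprime (by norm_num)
    · exact absurd hprime (by norm_num)
    · exact absurd hprime (by norm_num)
    · exact absurd hprime (by norm_num)
    · exact absurd hprime (by norm_num)
    · exact absurd hprime (by norm_num)
    · exact hprinc P hP0 _ (eq_span_of_inert_fortysix hθ h3 (by norm_num) hP)
    · exact absurd hprime (by norm_num)
    · exact absurd hprime (by norm_num)
    · exact absurd hprime (by norm_num)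
    · exact absurd hprime (by norm_num)
    · exact absurd hprime (by norm_num)
    · -- `p = 257`
      have h := eq_span_pair_of_unique_root_fortysix hθ h3 (Or.inr (Or.inr (Or.inr (Or.inr (Or.inr (Or.inr (Or.inr (Or.inr (Or.inr (Or.inr (Or.inr (Or.inr (Or.inr (Or.inr (Or.inr (Or.inr (Or.inr (Or.inr (Or.inr (Or.inl ⟨rfl, rfl⟩)))))))))))))))))))) hP hle
      simp only [Nat.cast_ofNat, Int.cast_ofNat] at h
      subst h
      exact mem_zpowers_of_mk0_eq a (cls_P257_103_fortysix hθ) ha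
    · exact absurd hprime (by norm_num)
    · exact absurd hprime (by norm_num)
    · exact absurd hprime (by norm_num)
    · exact absurd hprime (by norm_num)
    · exact absurd hprime (by norm_num)
    · -- `p = 263`
      have h := eq_span_pair_of_unique_root_fortysix hθ h3 (Or.inr (Or.inr (Or.inr (Or.inr (Or.inr (Or.inr (Or.inr (Or.inr (Or.inr (Or.inr (Or.inr (Or.inr (Or.inr (Or.inr (Or.inr (Or.inr (Or.inr (Or.inr (Or.inr (Or.inr (Or.inl ⟨rfl, rfl⟩))))))))))))))))))))) hP hle
      simp only [Nat.cast_ofNat, Int.cast_ofNat] at h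
      subst h
      exact mem_zpowers_of_mk0_eq a (cls_P263_150_fortysix hθ) ha
    · exact absurd hprime (by norm_num)
    · exact absurd hprime (by norm_num)
    · exact absurd hprime (by norm_num)
    · exact absurd hprime (by norm_num)
    · exact absurd hprime (by norm_num)
    · -- `p = 269` (splits)
      rcases eq_P269_fortysix hθ h3 hP with h | h | h <;> subst h
      · exact mem_zpowers_of_mk0_eq a (cls_P269_40_fortysix hθ) ha
      · exact hprinc _ hP0 _ (P269_136_eq_fortysix hθ)
      · exact mem_zpowers_of_mk0_eq a (cls_P269_139_fortysix hθ) ha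
    · exact absurd hprime (by norm_num)
    · exact hprinc P hP0 _ (eq_span_of_inert_fortysix hθ h3 (by norm_num) hP)
    · exact absurd hprime (by norm_num)
    · exact absurd hprime (by norm_num)
    · exact absurd hprime (by norm_num)
    · exact absurd hprime (by norm_num)
    · exact absurd hprime (by norm_num)
    · exact hprinc P hP0 _ (eq_span_of_inert_fortysix hθ h3 (by norm_num) hP)
    · exact absurd hprime (by norm_num)
    · exact absurd hprime (by norm_num)
    · exact absurd hprime (by norm_num)
    · -- `p = 281`
      have h := eq_span_pair_of_unique_root_fortysix hθ h3 (Or.inr (Or.inr (Or.inr (Or.inr (Or.inr (Or.inr (Or.inr (Or.inr (Or.inr (Or.inr (Or.inr (Or.inr (Or.inr (Or.inr (Or.inr (Or.inr (Or.inr (Or.inr (Or.inr (Or.inr (Or.inr (Or.inl ⟨rfl, rfl⟩)))))))))))))))))))))) hP hle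
      simp only [Nat.cast_ofNat, Int.cast_ofNat] at h
      subst h
      exact hprinc _ hP0 _ (P281_140_eq_fortysix hθ)
    · exact absurd hprime (by norm_num)
    · -- `p = 283` (splits)
      rcases eq_P283_fortysix hθ h3 hP with h | h | h <;> subst h
      · exact mem_zpowers_of_mk0_eq a (cls_P283_135_fortysix hθ) ha
      · exact mem_zpowers_of_mk0_eq a (cls_P283_196_fortysix hθ) ha
      · exact hprinc _ hP0 _ (P283_281_eq_fortysix hθ)
    · exact absurd hprime (by norm_num)
    · exact absurd hprime (by norm_num)
    · exact absurd hprime (by norm_num)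
    · exact absurd hprime (by norm_num)
    · exact absurd hprime (by norm_num)
    · exact absurd hprime (by norm_num)
    · exact absurd hprime (by norm_num)
    · exact absurd hprime (by norm_num)
    · exact absurd hprime (by norm_num)
    · exact hprinc P hP0 _ (eq_span_of_inert_fortysix hθ h3 (by norm_num) hP)
    · exact absurd hprime (by norm_num)
    · exact absurd hprime (by norm_num)
    · exact absurd hprime (by norm_num)
    · exact absurd hprime (by norm_num)
    · exact absurd hprime (by norm_num)
    · exact absurd hprime (by norm_num)
    · exact absurd hprime (by norm_num)
    · exact absurd hprime (by norm_num)
    · exact absurd hprime (by norm_num)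
    · exact absurd hprime (by norm_num)
    · exact absurd hprime (by norm_num)
    · exact absurd hprime (by norm_num)
    · exact absurd hprime (by norm_num)
    · exact hprinc P hP0 _ (eq_span_of_inert_fortysix hθ h3 (by norm_num) hP)
    · exact absurd hprime (by norm_num)
    · exact absurd hprime (by norm_num)
    · exact absurd hprime (by norm_num)
    · -- `p = 311`
      have h := eq_span_pair_of_unique_root_fortysix hθ h3 (Or.inr (Or.inr (Or.inr (Or.inr (Or.inr (Or.inr (Or.inr (Or.inr (Or.inr (Or.inr (Or.inr (Or.inr (Or.inr (Or.inr (Or.inr (Or.inr (Or.inr (Or.inr (Or.inr (Or.inr (Or.inr (Or.inr (Or.inl ⟨rfl, rfl⟩))))))))))))))))))))))) hP hle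
      simp only [Nat.cast_ofNat, Int.cast_ofNat] at h
      subst h
      exact mem_zpowers_of_mk0_eq a (cls_P311_90_fortysix hθ) ha
    · exact absurd hprime (by norm_num)
    · -- `p = 313`
      have h := eq_span_pair_of_unique_root_fortysix hθ h3 (Or.inr (Or.inr (Or.inr (Or.inr (Or.inr (Or.inr (Or.inr (Or.inr (Or.inr (Or.inr (Or.inr (Or.inr (Or.inr (Or.inr (Or.inr (Or.inr (Or.inr (Or.inr (Or.inr (Or.inr (Or.inr (Or.inr (Or.inr (Or.inl ⟨rfl, rfl⟩)))))))))))))))))))))))) hP hle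
      simp only [Nat.cast_ofNat, Int.cast_ofNat] at h
      subst h
      exact mem_zpowers_of_mk0_eq a (cls_P313_236_fortysix hθ) ha
    · exact absurd hprime (by norm_num)
    · exact absurd hprime (by norm_num)
    · exact absurd hprime (by norm_num)
    · -- `p = 317`
      have h := eq_span_pair_of_unique_root_fortysix hθ h3 (Or.inr (Or.inr (Or.inr (Or.inr (Or.inr (Or.inr (Or.inr (Or.inr (Or.inr (Or.inr (Or.inr (Or.inr (Or.inr (Or.inr (Or.inr (Or.inr (Or.inr (Or.inr (Or.inr (Or.inr (Or.inr (Or.inr (Or.inr (Or.inr (Or.inl ⟨rfl, rfl⟩))))))))))))))))))))))))) hP hle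
      simp only [Nat.cast_ofNat, Int.cast_ofNat] at h
      subst h
      exact mem_zpowers_of_mk0_eq a (cls_P317_247_fortysix hθ) ha
    · exact absurd hprime (by norm_num)
    · exact absurd hprime (by norm_num)
    · exact absurd hprime (by norm_num)
    · exact absurd hprime (by norm_num)
    · exact absurd hprime (by norm_num)
    · exact absurd hprime (by norm_num)
    · exact absurd hprime (by norm_num)
    · exact absurd hprime (by norm_num)
    · exact absurd hprime (by norm_num)
    · exact absurd hprime (by norm_num)
    · exact absurd hprime (by norm_num)
    · exact absurd hprime (by norm_num)
    · exact absurd hprime (by norm_num)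
    · -- `p = 331` (splits)
      rcases eq_P331_fortysix hθ h3 hP with h | h | h <;> subst h
      · exact mem_zpowers_of_mk0_eq a (cls_P331_219_fortysix hθ) ha
      · exact mem_zpowers_of_mk0_eq a (cls_P331_243_fortysix hθ) ha
      · exact mem_zpowers_of_mk0_eq a (cls_P331_246_fortysix hθ) ha
    · exact absurd hprime (by norm_num)
    · exact absurd hprime (by norm_num)
    · exact absurd hprime (by norm_num)
    · exact absurd hprime (by norm_num)
    · exact absurd hprime (by norm_num)
    · -- `p = 337`
      have h := eq_span_pair_of_unique_root_fortysix hθ h3 (Or.inr (Or.inr (Or.inr (Or.inr (Or.inr (Or.inr (Or.inr (Or.inr (Or.inr (Or.inr (Or.inr (Or.inr (Or.inr (Or.inr (Or.inr (Or.inr (Or.inr (Or.inr (Or.inr (Or.inr (Or.inr (Or.inr (Or.inr (Or.inr (Or.inr (Or.inl ⟨rfl, rfl⟩)))))))))))))))))))))))))) hP hle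
      simp only [Nat.cast_ofNat, Int.cast_ofNat] at h
      subst h
      exact mem_zpowers_of_mk0_eq a (cls_P337_213_fortysix hθ) ha
    · exact absurd hprime (by norm_num)
    · exact absurd hprime (by norm_num)
    · exact absurd hprime (by norm_num)
    · exact absurd hprime (by norm_num)
    · exact absurd hprime (by norm_num)
    · exact absurd hprime (by norm_num)
    · exact absurd hprime (by norm_num)
    · exact absurd hprime (by norm_num)
    · exact absurd hprime (by norm_num)
    · -- `p = 347`
      have h := eq_span_pair_of_unique_root_fortysix hθ h3 (Or.inr (Or.inr (Or.inr (Or.inr (Or.inr (Or.inr (Or.inr (Or.inr (Or.inr (Or.inr (Or.inr (Or.inr (Or.inr (Or.inr (Or.inr (Or.inr (Or.inr (Or.inr (Or.inr (Or.inr (Or.inr (Or.inr (Or.inr (Or.inr (Or.inr (Or.inr (Or.inl ⟨rfl, rfl⟩))))))))))))))))))))))))))) hP hle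
      simp only [Nat.cast_ofNat, Int.cast_ofNat] at h
      subst h
      exact mem_zpowers_of_mk0_eq a (cls_P347_339_fortysix hθ) ha
    · exact absurd hprime (by norm_num)
    · -- `p = 349`
      have h := eq_span_pair_of_unique_root_fortysix hθ h3 (Or.inr (Or.inr (Or.inr (Or.inr (Or.inr (Or.inr (Or.inr (Or.inr (Or.inr (Or.inr (Or.inr (Or.inr (Or.inr (Or.inr (Or.inr (Or.inr (Or.inr (Or.inr (Or.inr (Or.inr (Or.inr (Or.inr (Or.inr (Or.inr (Or.inr (Or.inr (Or.inr (Or.inl ⟨rfl, rfl⟩)))))))))))))))))))))))))))) hP hle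
      simp only [Nat.cast_ofNat, Int.cast_ofNat] at h
      subst h
      exact mem_zpowers_of_mk0_eq a (cls_P349_238_fortysix hθ) ha
    · exact absurd hprime (by norm_num)
    · exact absurd hprime (by norm_num)
    · exact absurd hprime (by norm_num)
    · -- `p = 353` (splits)
      rcases eq_P353_fortysix hθ h3 hP with h | h | h <;> subst h
      · exact mem_zpowers_of_mk0_eq a (cls_P353_69_fortysix hθ) ha
      · exact mem_zpowers_of_mk0_eq a (cls_P353_72_fortysix hθ) ha
      · exact mem_zpowers_of_mk0_eq a (cls_P353_258_fortysix hθ) ha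
    · exact absurd hprime (by norm_num)
    · exact absurd hprime (by norm_num)
    · exact absurd hprime (by norm_num)
    · exact absurd hprime (by norm_num)
    · exact absurd hprime (by norm_num)
    · exact hprinc P hP0 _ (eq_span_of_inert_fortysix hθ h3 (by norm_num) hP)
    · exact absurd hprime (by norm_num)
    · exact absurd hprime (by norm_num)
    · exact absurd hprime (by norm_num)
    · exact absurd hprime (by norm_num)
    · exact absurd hprime (by norm_num)
    · exact absurd hprime (by norm_num)
    · exact absurd hprime (by norm_num)
    · -- `p = 367`
      have h := eq_span_pair_of_unique_root_fortysix hθ h3 (Or.inr (Or.inr (Or.inr (Or.inr (Or.inr (Or.inr (Or.inr (Or.inr (Or.inr (Or.inr (Or.inr (Or.inr (Or.inr (Or.inr (Or.inr (Or.inr (Or.inr (Or.inr (Or.inr (Or.inr (Or.inr (Or.inr (Or.inr (Or.inr (Or.inr (Or.inr (Or.inr (Or.inr (Or.inl ⟨rfl, rfl⟩))))))))))))))))))))))))))))) hP hle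
      simp only [Nat.cast_ofNat, Int.cast_ofNat] at h
      subst h
      exact mem_zpowers_of_mk0_eq a (cls_P367_73_fortysix hθ) ha
    · exact absurd hprime (by norm_num)
    · exact absurd hprime (by norm_num)
    · exact absurd hprime (by norm_num)
    · exact absurd hprime (by norm_num)
    · exact absurd hprime (by norm_num)
    · -- `p = 373`
      have h := eq_span_pair_of_unique_root_fortysix hθ h3 (Or.inr (Or.inr (Or.inr (Or.inr (Or.inr (Or.inr (Or.inr (Or.inr (Or.inr (Or.inr (Or.inr (Or.inr (Or.inr (Or.inr (Or.inr (Or.inr (Or.inr (Or.inr (Or.inr (Or.inr (Or.inr (Or.inr (Or.inr (Or.inr (Or.inr (Or.inr (Or.inr (Or.inr (Or.inr (Or.inl ⟨rfl, rfl⟩)))))))))))))))))))))))))))))) hP hle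
      simp only [Nat.cast_ofNat, Int.cast_ofNat] at h
      subst h
      exact mem_zpowers_of_mk0_eq a (cls_P373_343_fortysix hθ) ha
    · exact absurd hprime (by norm_num)
    · exact absurd hprime (by norm_num)
    · exact absurd hprime (by norm_num)
    · exact absurd hprime (by norm_num)
    · exact absurd hprime (by norm_num)
    · exact hprinc P hP0 _ (eq_span_of_inert_fortysix hθ h3 (by norm_num) hP)
    · exact absurd hprime (by norm_num)
    · exact absurd hprime (by norm_num)
    · exact absurd hprime (by norm_num)
    · exact hprinc P hP0 _ (eq_span_of_inert_fortysix hθ h3 (by norm_num) hP)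
    · exact absurd hprime (by norm_num)
    · exact absurd hprime (by norm_num)
    · exact absurd hprime (by norm_num)
    · exact absurd hprime (by norm_num)
    · exact absurd hprime (by norm_num)
    · -- `p = 389`
      have h := eq_span_pair_of_unique_root_fortysix hθ h3 (Or.inr (Or.inr (Or.inr (Or.inr (Or.inr (Or.inr (Or.inr (Or.inr (Or.inr (Or.inr (Or.inr (Or.inr (Or.inr (Or.inr (Or.inr (Or.inr (Or.inr (Or.inr (Or.inr (Or.inr (Or.inr (Or.inr (Or.inr (Or.inr (Or.inr (Or.inr (Or.inr (Or.inr (Or.inr (Or.inr (Or.inl ⟨rfl, rfl⟩))))))))))))))))))))))))))))))) hP hle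
      simp only [Nat.cast_ofNat, Int.cast_ofNat] at h
      subst h
      exact mem_zpowers_of_mk0_eq a (cls_P389_236_fortysix hθ) ha
    · exact absurd hprime (by norm_num)
    · exact absurd hprime (by norm_num)
    · exact absurd hprime (by norm_num)
    · exact absurd hprime (by norm_num)
    · exact absurd hprime (by norm_num)
    · exact absurd hprime (by norm_num)
    · exact absurd hprime (by norm_num)
    · -- `p = 397`
      have h := eq_span_pair_of_unique_root_fortysix hθ h3 (Or.inr (Or.inr (Or.inr (Or.inr (Or.inr (Or.inr (Or.inr (Or.inr (Or.inr (Or.inr (Or.inr (Or.inr (Or.inr (Or.inr (Or.inr (Or.inr (Or.inr (Or.inr (Or.inr (Or.inr (Or.inr (Or.inr (Or.inr (Or.inr (Or.inr (Or.inr (Or.inr (Or.inr (Or.inr (Or.inr (Or.inr (Or.inl ⟨rfl, rfl⟩)))))))))))))))))))))))))))))))) hP hle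
      simp only [Nat.cast_ofNat, Int.cast_ofNat] at h
      subst h
      exact mem_zpowers_of_mk0_eq a (cls_P397_325_fortysix hθ) ha
    · exact absurd hprime (by norm_num)
    · exact absurd hprime (by norm_num)
    · exact absurd hprime (by norm_num)
    · -- `p = 401`
      have h := eq_span_pair_of_unique_root_fortysix hθ h3 (Or.inr (Or.inr (Or.inr (Or.inr (Or.inr (Or.inr (Or.inr (Or.inr (Or.inr (Or.inr (Or.inr (Or.inr (Or.inr (Or.inr (Or.inr (Or.inr (Or.inr (Or.inr (Or.inr (Or.inr (Or.inr (Or.inr (Or.inr (Or.inr (Or.inr (Or.inr (Or.inr (Or.inr (Or.inr (Or.inr (Or.inr (Or.inr (Or.inl ⟨rfl, rfl⟩))))))))))))))))))))))))))))))))) hP hle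
      simp only [Nat.cast_ofNat, Int.cast_ofNat] at h
      subst h
      exact mem_zpowers_of_mk0_eq a (cls_P401_73_fortysix hθ) ha
    · exact absurd hprime (by norm_num)
    · exact absurd hprime (by norm_num)
    · exact absurd hprime (by norm_num)
    · exact absurd hprime (by norm_num)
    · exact absurd hprime (by norm_num)
    · exact absurd hprime (by norm_num)
    · exact absurd hprime (by norm_num)
    · -- `p = 409`
      have h := eq_span_pair_of_unique_root_fortysix hθ h3 (Or.inr (Or.inr (Or.inr (Or.inr (Or.inr (Or.inr (Or.inr (Or.inr (Or.inr (Or.inr (Or.inr (Or.inr (Or.inr (Or.inr (Or.inr (Or.inr (Or.inr (Or.inr (Or.inr (Or.inr (Or.inr (Or.inr (Or.inr (Or.inr (Or.inr (Or.inr (Or.inr (Or.inr (Or.inr (Or.inr (Or.inr (Or.inr (Or.inr (Or.inl ⟨rfl, rfl⟩)))))))))))))))))))))))))))))))))) hP hle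
      simp only [Nat.cast_ofNat, Int.cast_ofNat] at h
      subst h
      exact mem_zpowers_of_mk0_eq a (cls_P409_49_fortysix hθ) ha
    · exact absurd hprime (by norm_num)
    · exact absurd hprime (by norm_num)
    · exact absurd hprime (by norm_num)
    · exact absurd hprime (by norm_num)
    · exact absurd hprime (by norm_num)
    · exact absurd hprime (by norm_num)
    · exact absurd hprime (by norm_num)
    · exact absurd hprime (by norm_num)
    · exact absurd hprime (by norm_num)
    · -- `p = 419`
      have h := eq_span_pair_of_unique_root_fortysix hθ h3 (Or.inr (Or.inr (Or.inr (Or.inr (Or.inr (Or.inr (Or.inr (Or.inr (Or.inr (Or.inr (Or.inr (Or.inr (Or.inr (Or.inr (Or.inr (Or.inr (Or.inr (Or.inr (Or.inr (Or.inr (Or.inr (Or.inr (Or.inr (Or.inr (Or.inr (Or.inr (Or.inr (Or.inr (Or.inr (Or.inr (Or.inr (Or.inr (Or.inr (Or.inr (⟨rfl, rfl⟩))))))))))))))))))))))))))))))))))) hP hle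
      simp only [Nat.cast_ofNat, Int.cast_ofNat] at h
      subst h
      exact mem_zpowers_of_mk0_eq a (cls_P419_170_fortysix hθ) ha
  have hC : C ∈ H := by rw [htop]; exact Subgroup.mem_top C
  obtain ⟨k, rfl⟩ := Subgroup.mem_zpowers_iff.mp hC
  obtain ⟨q, r, hr, rfl⟩ : ∃ q r : ℤ, (r = 0 ∨ r = 1 ∨ r = 2 ∨ r = 3 ∨ r = 4 ∨ r = 5 ∨ r = 6 ∨ r = 7 ∨ r = 8 ∨ r = 9 ∨ r = 10 ∨ r = 11) ∧ k = 12 * q + r :=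
    ⟨k / 12, k % 12, by omega, by omega⟩
  rw [zpow_add, zpow_mul, ham, one_zpow, one_mul]
  rcases hr with rfl | rfl | rfl | rfl | rfl | rfl | rfl | rfl | rfl | rfl | rfl | rfl
  · exact Or.inl (zpow_zero a)
  · right; left
    rw [show (1 : ℤ) = 1 + 12 * (0) by norm_num, zpow_add, zpow_mul, ham, one_zpow, mul_one,
      zpow_one, ← ha]
  · right; right; left
    rw [show (2 : ℤ) = 2 + 12 * (0) by norm_num, zpow_add, zpow_mul, ham, one_zpow, mul_one,
      ← ha, ← cls_P11_3_fortysix hθ]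
  · right; right; right; left
    rw [show (3 : ℤ) = 3 + 12 * (0) by norm_num, zpow_add, zpow_mul, ham, one_zpow, mul_one,
      ← ha, ← cls_P3_2_fortysix hθ]
  · right; right; right; right; left
    rw [show (4 : ℤ) = 4 + 12 * (0) by norm_num, zpow_add, zpow_mul, ham, one_zpow, mul_one,
      ← ha, ← cls_P29_4_fortysix hθ]
  · right; right; right; right; right; left
    rw [show (5 : ℤ) = 5 + 12 * (0) by norm_num, zpow_add, zpow_mul, ham, one_zpow, mul_one,
      ← ha, ← cls_P67_48_fortysix hθ]
  · right; right; right; right; right; right; left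
    rw [show (6 : ℤ) = 6 + 12 * (0) by norm_num, zpow_add, zpow_mul, ham, one_zpow, mul_one,
      ← ha, ← cls_I3sq2_fortysix hθ]
  · right; right; right; right; right; right; right; left
    rw [show (7 : ℤ) = -5 + 12 * (1) by norm_num, zpow_add, zpow_mul, ham, one_zpow, mul_one,
      ← ha, ← cls_P23_10_fortysix hθ]
  · right; right; right; right; right; right; right; right; left
    rw [show (8 : ℤ) = -4 + 12 * (1) by norm_num, zpow_add, zpow_mul, ham, one_zpow, mul_one,
      ← ha, ← cls_P17_4_fortysix hθ]
  · right; right; right; right; right; right; right; right; right; left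
    rw [show (9 : ℤ) = -3 + 12 * (1) by norm_num, zpow_add, zpow_mul, ham, one_zpow, mul_one,
      ← ha, ← cls_P31_30_fortysix hθ]
  · right; right; right; right; right; right; right; right; right; right; left
    rw [show (10 : ℤ) = -2 + 12 * (1) by norm_num, zpow_add, zpow_mul, ham, one_zpow, mul_one,
      ← ha, ← cls_P23_3_fortysix hθ]
  · right; right; right; right; right; right; right; right; right; right; right
    rw [show (11 : ℤ) = -1 + 12 * (1) by norm_num, zpow_add, zpow_mul, ham, one_zpow, mul_one,
      ← ha, ← cls_I51_38_fortysix hθ]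


end Field


/-! ### The ideal classes of `ℤ[X]/(f₄₆)` and Gompf's conjecture for the traces `46` and `-41` -/

section Matrices

set_option maxHeartbeats 1000000 in
/-- **The ideal classes of `ℤ[Θ₄₆] = ℤ[X]/(f₄₆)`**: every non-zero ideal is in the class of one of
`⟨Θ - 1, 1⟩`, `⟨Θ - 14, 19⟩`, `⟨Θ - 3, 11⟩`, `⟨Θ - 2, 3⟩`, `⟨Θ - 4, 29⟩`, `⟨Θ - 48, 67⟩`, `⟨Θ - 5, 9⟩`, `⟨Θ - 10, 23⟩`, `⟨Θ - 4, 17⟩`, `⟨Θ - 30, 31⟩`, `⟨Θ - 3, 23⟩`, `⟨Θ - 38, 51⟩` (these representatives cover `C(ℤ[Θ₄₆])`). [cite: KimYamada2023, §6.1 (proof of Thm. B)] -/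
theorem ideal_class_adjoinRoot_fortysix (J : Ideal (AdjoinRoot (csPoly 46))) (hJ : J ≠ ⊥) :
    ∃ x y : AdjoinRoot (csPoly 46), x ≠ 0 ∧ y ≠ 0 ∧
      (span {x} * J = span {y} * csIdeal 1 1 46 ∨ span {x} * J = span {y} * csIdeal 14 19 46 ∨ span {x} * J = span {y} * csIdeal 3 11 46 ∨ span {x} * J = span {y} * csIdeal 2 3 46 ∨ span {x} * J = span {y} * csIdeal 4 29 46 ∨ span {x} * J = span {y} * csIdeal 48 67 46 ∨ span {x} * J = span {y} * csIdeal 5 9 46 ∨ span {x} * J = span {y} * csIdeal 10 23 46 ∨ span {x} * J = span {y} * csIdeal 4 17 46 ∨ span {x} * J = span {y} * csIdeal 30 31 46 ∨ span {x} * J = span {y} * csIdeal 3 23 46 ∨ span {x} * J = span {y} * csIdeal 38 51 46) := by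
  classical
  set θ' := AdjoinRoot.root (csPolyQ 46) with hθ'
  have hθ : aeval θ' (csPoly 46) = 0 := aeval_root_csPoly 46
  have h3 : finrank ℚ (CSField 46) = 3 := finrank_CSField 46
  obtain ⟨e, he⟩ := exists_ringEquiv_adjoinRoot_of_sq hθ h3 csDisc_fortysix_sq
  set I : Ideal (𝓞 (CSField 46)) := J.map e with hI
  have hIJ : I.map (e.symm : 𝓞 (CSField 46) →+* AdjoinRoot (csPoly 46)) = J := by
    rw [hI]
    exact Ideal.map_of_equiv e (I := J)
  have hI0 : I ≠ ⊥ := by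
    intro h0
    apply hJ
    rw [← hIJ, h0, Ideal.map_bot]
  have hImem : I ∈ (Ideal (𝓞 (CSField 46)))⁰ := mem_nonZeroDivisors_iff_ne_zero.mpr hI0
  have hsymm : ∀ x, (e.symm : 𝓞 (CSField 46) →+* AdjoinRoot (csPoly 46)) (e x) = x :=
    fun x => e.symm_apply_apply x
  have hP19_14 : (span {(19 : 𝓞 (CSField 46)), thetaInt hθ - 14}).map
      (e.symm : 𝓞 (CSField 46) →+* AdjoinRoot (csPoly 46)) = csIdeal 14 19 46 := by
    rw [Ideal.map_span, Set.image_insert_eq, Set.image_singleton, map_sub, ← he, hsymm, map_ofNat,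
      map_ofNat, csIdeal, Set.pair_comm]
    simp
  have hP11_3 : (span {(11 : 𝓞 (CSField 46)), thetaInt hθ - 3}).map
      (e.symm : 𝓞 (CSField 46) →+* AdjoinRoot (csPoly 46)) = csIdeal 3 11 46 := by
    rw [Ideal.map_span, Set.image_insert_eq, Set.image_singleton, map_sub, ← he, hsymm, map_ofNat,
      map_ofNat, csIdeal, Set.pair_comm]
    simp
  have hP3_2 : (span {(3 : 𝓞 (CSField 46)), thetaInt hθ - 2}).map
      (e.symm : 𝓞 (CSField 46) →+* AdjoinRoot (csPoly 46)) = csIdeal 2 3 46 := by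
    rw [Ideal.map_span, Set.image_insert_eq, Set.image_singleton, map_sub, ← he, hsymm, map_ofNat,
      map_ofNat, csIdeal, Set.pair_comm]
    simp
  have hP29_4 : (span {(29 : 𝓞 (CSField 46)), thetaInt hθ - 4}).map
      (e.symm : 𝓞 (CSField 46) →+* AdjoinRoot (csPoly 46)) = csIdeal 4 29 46 := by
    rw [Ideal.map_span, Set.image_insert_eq, Set.image_singleton, map_sub, ← he, hsymm, map_ofNat,
      map_ofNat, csIdeal, Set.pair_comm]
    simp
  have hP67_48 : (span {(67 : 𝓞 (CSField 46)), thetaInt hθ - 48}).map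
      (e.symm : 𝓞 (CSField 46) →+* AdjoinRoot (csPoly 46)) = csIdeal 48 67 46 := by
    rw [Ideal.map_span, Set.image_insert_eq, Set.image_singleton, map_sub, ← he, hsymm, map_ofNat,
      map_ofNat, csIdeal, Set.pair_comm]
    simp
  have hI3sq2 : (span {(9 : 𝓞 (CSField 46)), thetaInt hθ - 5}).map
      (e.symm : 𝓞 (CSField 46) →+* AdjoinRoot (csPoly 46)) = csIdeal 5 9 46 := by
    rw [Ideal.map_span, Set.image_insert_eq, Set.image_singleton, map_sub, ← he, hsymm, map_ofNat,
      map_ofNat, csIdeal, Set.pair_comm]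
    simp
  have hP23_10 : (span {(23 : 𝓞 (CSField 46)), thetaInt hθ - 10}).map
      (e.symm : 𝓞 (CSField 46) →+* AdjoinRoot (csPoly 46)) = csIdeal 10 23 46 := by
    rw [Ideal.map_span, Set.image_insert_eq, Set.image_singleton, map_sub, ← he, hsymm, map_ofNat,
      map_ofNat, csIdeal, Set.pair_comm]
    simp
  have hP17_4 : (span {(17 : 𝓞 (CSField 46)), thetaInt hθ - 4}).map
      (e.symm : 𝓞 (CSField 46) →+* AdjoinRoot (csPoly 46)) = csIdeal 4 17 46 := by
    rw [Ideal.map_span, Set.image_insert_eq, Set.image_singleton, map_sub, ← he, hsymm, map_ofNat,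
      map_ofNat, csIdeal, Set.pair_comm]
    simp
  have hP31_30 : (span {(31 : 𝓞 (CSField 46)), thetaInt hθ - 30}).map
      (e.symm : 𝓞 (CSField 46) →+* AdjoinRoot (csPoly 46)) = csIdeal 30 31 46 := by
    rw [Ideal.map_span, Set.image_insert_eq, Set.image_singleton, map_sub, ← he, hsymm, map_ofNat,
      map_ofNat, csIdeal, Set.pair_comm]
    simp
  have hP23_3 : (span {(23 : 𝓞 (CSField 46)), thetaInt hθ - 3}).map
      (e.symm : 𝓞 (CSField 46) →+* AdjoinRoot (csPoly 46)) = csIdeal 3 23 46 := by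
    rw [Ideal.map_span, Set.image_insert_eq, Set.image_singleton, map_sub, ← he, hsymm, map_ofNat,
      map_ofNat, csIdeal, Set.pair_comm]
    simp
  have hI51_38 : (span {(51 : 𝓞 (CSField 46)), thetaInt hθ - 38}).map
      (e.symm : 𝓞 (CSField 46) →+* AdjoinRoot (csPoly 46)) = csIdeal 38 51 46 := by
    rw [Ideal.map_span, Set.image_insert_eq, Set.image_singleton, map_sub, ← he, hsymm, map_ofNat,
      map_ofNat, csIdeal, Set.pair_comm]
    simp
  have hcase : ∀ (P : Ideal (𝓞 (CSField 46))) (hP0 : P ∈ (Ideal (𝓞 (CSField 46)))⁰)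
      (Q : Ideal (AdjoinRoot (csPoly 46))),
      P.map (e.symm : 𝓞 (CSField 46) →+* AdjoinRoot (csPoly 46)) = Q →
      ClassGroup.mk0 ⟨I, hImem⟩ = ClassGroup.mk0 ⟨P, hP0⟩ →
        ∃ x y : AdjoinRoot (csPoly 46), x ≠ 0 ∧ y ≠ 0 ∧ span {x} * J = span {y} * Q := by
    intro P hP0 Q hPQ hcls
    obtain ⟨x, y, hx, hy, hxy⟩ := ClassGroup.mk0_eq_mk0_iff.mp hcls
    refine ⟨(e.symm : 𝓞 (CSField 46) →+* AdjoinRoot (csPoly 46)) x,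
      (e.symm : 𝓞 (CSField 46) →+* AdjoinRoot (csPoly 46)) y,
      (map_ne_zero_iff _ e.symm.injective).mpr hx, (map_ne_zero_iff _ e.symm.injective).mpr hy, ?_⟩
    have h := congrArg (Ideal.map (e.symm : 𝓞 (CSField 46) →+* AdjoinRoot (csPoly 46))) hxy
    simp only [Ideal.map_mul, Ideal.map_span, Set.image_singleton] at h
    rw [hIJ, hPQ] at h
    exact h
  rcases classGroup_mem_fortysix hθ h3 (ClassGroup.mk0 ⟨I, hImem⟩) with h1 | hcl | hcl | hcl | hcl | hcl | hcl | hcl | hcl | hcl | hcl | hcl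
  · obtain ⟨z, hz⟩ := ((ClassGroup.mk0_eq_one_iff hImem).mp h1).principal
    have hz' : I = span {z} := by rw [hz, submodule_span_eq]
    have hz0 : z ≠ 0 := by
      rintro rfl
      apply hI0
      rw [hz', Ideal.span_singleton_eq_bot]
    refine ⟨1, (e.symm : 𝓞 (CSField 46) →+* AdjoinRoot (csPoly 46)) z, one_ne_zero,
      (map_ne_zero_iff _ e.symm.injective).mpr hz0, Or.inl ?_⟩
    rw [Ideal.span_singleton_one, Ideal.top_mul, csIdeal_one_one, Ideal.mul_top, ← hIJ, hz',
      Ideal.map_span, Set.image_singleton]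
  · obtain ⟨x, y, hx, hy, h⟩ := hcase _ _ _ hP19_14 hcl
    exact ⟨x, y, hx, hy, Or.inr (Or.inl h)⟩
  · obtain ⟨x, y, hx, hy, h⟩ := hcase _ _ _ hP11_3 hcl
    exact ⟨x, y, hx, hy, Or.inr (Or.inr (Or.inl h))⟩
  · obtain ⟨x, y, hx, hy, h⟩ := hcase _ _ _ hP3_2 hcl
    exact ⟨x, y, hx, hy, Or.inr (Or.inr (Or.inr (Or.inl h)))⟩
  · obtain ⟨x, y, hx, hy, h⟩ := hcase _ _ _ hP29_4 hcl
    exact ⟨x, y, hx, hy, Or.inr (Or.inr (Or.inr (Or.inr (Or.inl h))))⟩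
  · obtain ⟨x, y, hx, hy, h⟩ := hcase _ _ _ hP67_48 hcl
    exact ⟨x, y, hx, hy, Or.inr (Or.inr (Or.inr (Or.inr (Or.inr (Or.inl h)))))⟩
  · obtain ⟨x, y, hx, hy, h⟩ := hcase _ _ _ hI3sq2 hcl
    exact ⟨x, y, hx, hy, Or.inr (Or.inr (Or.inr (Or.inr (Or.inr (Or.inr (Or.inl h))))))⟩
  · obtain ⟨x, y, hx, hy, h⟩ := hcase _ _ _ hP23_10 hcl
    exact ⟨x, y, hx, hy, Or.inr (Or.inr (Or.inr (Or.inr (Or.inr (Or.inr (Or.inr (Or.inl h)))))))⟩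
  · obtain ⟨x, y, hx, hy, h⟩ := hcase _ _ _ hP17_4 hcl
    exact ⟨x, y, hx, hy, Or.inr (Or.inr (Or.inr (Or.inr (Or.inr (Or.inr (Or.inr (Or.inr (Or.inl h))))))))⟩
  · obtain ⟨x, y, hx, hy, h⟩ := hcase _ _ _ hP31_30 hcl
    exact ⟨x, y, hx, hy, Or.inr (Or.inr (Or.inr (Or.inr (Or.inr (Or.inr (Or.inr (Or.inr (Or.inr (Or.inl h)))))))))⟩
  · obtain ⟨x, y, hx, hy, h⟩ := hcase _ _ _ hP23_3 hcl
    exact ⟨x, y, hx, hy, Or.inr (Or.inr (Or.inr (Or.inr (Or.inr (Or.inr (Or.inr (Or.inr (Or.inr (Or.inr (Or.inl h))))))))))⟩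
  · obtain ⟨x, y, hx, hy, h⟩ := hcase _ _ _ hI51_38 hcl
    exact ⟨x, y, hx, hy, Or.inr (Or.inr (Or.inr (Or.inr (Or.inr (Or.inr (Or.inr (Or.inr (Or.inr (Or.inr (Or.inr (h)))))))))))⟩

/-- `19 ∣ f₄₆(14)`: `(14, 19, 46) ∈ 𝒞𝒮`. [cite: KimYamada2023, §6.1 (proof of Thm. B)] -/
theorem rep0_dvd_eval_csPoly_fortysix : (19 : ℤ) ∣ (csPoly 46).eval 14 := by
  rw [eval_csPoly]; norm_num

/-- `11 ∣ f₄₆(3)`: `(3, 11, 46) ∈ 𝒞𝒮`. [cite: KimYamada2023, §6.1 (proof of Thm. B)] -/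
theorem rep1_dvd_eval_csPoly_fortysix : (11 : ℤ) ∣ (csPoly 46).eval 3 := by
  rw [eval_csPoly]; norm_num

/-- `3 ∣ f₄₆(2)`: `(2, 3, 46) ∈ 𝒞𝒮`. [cite: KimYamada2023, §6.1 (proof of Thm. B)] -/
theorem rep2_dvd_eval_csPoly_fortysix : (3 : ℤ) ∣ (csPoly 46).eval 2 := by
  rw [eval_csPoly]; norm_num

/-- `29 ∣ f₄₆(4)`: `(4, 29, 46) ∈ 𝒞𝒮`. [cite: KimYamada2023, §6.1 (proof of Thm. B)] -/
theorem rep3_dvd_eval_csPoly_fortysix : (29 : ℤ) ∣ (csPoly 46).eval 4 := by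
  rw [eval_csPoly]; norm_num

/-- `67 ∣ f₄₆(48)`: `(48, 67, 46) ∈ 𝒞𝒮`. [cite: KimYamada2023, §6.1 (proof of Thm. B)] -/
theorem rep4_dvd_eval_csPoly_fortysix : (67 : ℤ) ∣ (csPoly 46).eval 48 := by
  rw [eval_csPoly]; norm_num

/-- `9 ∣ f₄₆(5)`: `(5, 9, 46) ∈ 𝒞𝒮`. [cite: KimYamada2023, §6.1 (proof of Thm. B)] -/
theorem rep5_dvd_eval_csPoly_fortysix : (9 : ℤ) ∣ (csPoly 46).eval 5 := by
  rw [eval_csPoly]; norm_num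

/-- `23 ∣ f₄₆(10)`: `(10, 23, 46) ∈ 𝒞𝒮`. [cite: KimYamada2023, §6.1 (proof of Thm. B)] -/
theorem rep6_dvd_eval_csPoly_fortysix : (23 : ℤ) ∣ (csPoly 46).eval 10 := by
  rw [eval_csPoly]; norm_num

/-- `17 ∣ f₄₆(4)`: `(4, 17, 46) ∈ 𝒞𝒮`. [cite: KimYamada2023, §6.1 (proof of Thm. B)] -/
theorem rep7_dvd_eval_csPoly_fortysix : (17 : ℤ) ∣ (csPoly 46).eval 4 := by
  rw [eval_csPoly]; norm_num

/-- `31 ∣ f₄₆(30)`: `(30, 31, 46) ∈ 𝒞𝒮`. [cite: KimYamada2023, §6.1 (proof of Thm. B)] -/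
theorem rep8_dvd_eval_csPoly_fortysix : (31 : ℤ) ∣ (csPoly 46).eval 30 := by
  rw [eval_csPoly]; norm_num

/-- `23 ∣ f₄₆(3)`: `(3, 23, 46) ∈ 𝒞𝒮`. [cite: KimYamada2023, §6.1 (proof of Thm. B)] -/
theorem rep9_dvd_eval_csPoly_fortysix : (23 : ℤ) ∣ (csPoly 46).eval 3 := by
  rw [eval_csPoly]; norm_num

/-- `51 ∣ f₄₆(38)`: `(38, 51, 46) ∈ 𝒞𝒮`. [cite: KimYamada2023, §6.1 (proof of Thm. B)] -/
theorem rep10_dvd_eval_csPoly_fortysix : (51 : ℤ) ∣ (csPoly 46).eval 38 := by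
  rw [eval_csPoly]; norm_num

/-- **Every Cappell–Shaneson matrix of trace `46` is similar to one of 12 standard matrices**
(Prop. 2.14). [cite: KimYamada2023, §6.1 (proof of Thm. B) and Prop. 2.14] -/
theorem isConj_standardCSMatrix_of_trace_eq_fortysix (A : SL(3, ℤ))
    (hdet : ((A : Matrix (Fin 3) (Fin 3) ℤ) - 1).det = 1)
    (htr : Matrix.trace (A : Matrix (Fin 3) (Fin 3) ℤ) = 46) :
    IsConj A (standardCSMatrix 1 1 46 (one_dvd _)) ∨
      IsConj A (standardCSMatrix 14 19 46 rep0_dvd_eval_csPoly_fortysix) ∨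
      IsConj A (standardCSMatrix 3 11 46 rep1_dvd_eval_csPoly_fortysix) ∨
      IsConj A (standardCSMatrix 2 3 46 rep2_dvd_eval_csPoly_fortysix) ∨
      IsConj A (standardCSMatrix 4 29 46 rep3_dvd_eval_csPoly_fortysix) ∨
      IsConj A (standardCSMatrix 48 67 46 rep4_dvd_eval_csPoly_fortysix) ∨
      IsConj A (standardCSMatrix 5 9 46 rep5_dvd_eval_csPoly_fortysix) ∨
      IsConj A (standardCSMatrix 10 23 46 rep6_dvd_eval_csPoly_fortysix) ∨
      IsConj A (standardCSMatrix 4 17 46 rep7_dvd_eval_csPoly_fortysix) ∨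
      IsConj A (standardCSMatrix 30 31 46 rep8_dvd_eval_csPoly_fortysix) ∨
      IsConj A (standardCSMatrix 3 23 46 rep9_dvd_eval_csPoly_fortysix) ∨
      IsConj A (standardCSMatrix 38 51 46 rep10_dvd_eval_csPoly_fortysix) := by
  have hcover : ∀ J : Ideal (AdjoinRoot (csPoly 46)), J ≠ ⊥ →
      ∃ (c d : ℤ) (_ : d ∣ (csPoly 46).eval c) (x y : AdjoinRoot (csPoly 46)),
        x ≠ 0 ∧ y ≠ 0 ∧ Ideal.span {x} * J = Ideal.span {y} * csIdeal c d 46 ∧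
          ((c = 1 ∧ d = 1) ∨ (c = 14 ∧ d = 19) ∨ (c = 3 ∧ d = 11) ∨ (c = 2 ∧ d = 3) ∨ (c = 4 ∧ d = 29) ∨ (c = 48 ∧ d = 67) ∨ (c = 5 ∧ d = 9) ∨ (c = 10 ∧ d = 23) ∨ (c = 4 ∧ d = 17) ∨ (c = 30 ∧ d = 31) ∨ (c = 3 ∧ d = 23) ∨ (c = 38 ∧ d = 51)) := by
    intro J hJ
    obtain ⟨x, y, hx, hy, hxy⟩ := ideal_class_adjoinRoot_fortysix J hJ
    rcases hxy with h0 | h1 | h2 | h3 | h4 | h5 | h6 | h7 | h8 | h9 | h10 | h11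
    · exact ⟨1, 1, one_dvd _, x, y, hx, hy, h0, Or.inl ⟨rfl, rfl⟩⟩
    · exact ⟨14, 19, rep0_dvd_eval_csPoly_fortysix, x, y, hx, hy, h1, Or.inr (Or.inl ⟨rfl, rfl⟩)⟩
    · exact ⟨3, 11, rep1_dvd_eval_csPoly_fortysix, x, y, hx, hy, h2, Or.inr (Or.inr (Or.inl ⟨rfl, rfl⟩))⟩
    · exact ⟨2, 3, rep2_dvd_eval_csPoly_fortysix, x, y, hx, hy, h3, Or.inr (Or.inr (Or.inr (Or.inl ⟨rfl, rfl⟩)))⟩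
    · exact ⟨4, 29, rep3_dvd_eval_csPoly_fortysix, x, y, hx, hy, h4, Or.inr (Or.inr (Or.inr (Or.inr (Or.inl ⟨rfl, rfl⟩))))⟩
    · exact ⟨48, 67, rep4_dvd_eval_csPoly_fortysix, x, y, hx, hy, h5, Or.inr (Or.inr (Or.inr (Or.inr (Or.inr (Or.inl ⟨rfl, rfl⟩)))))⟩
    · exact ⟨5, 9, rep5_dvd_eval_csPoly_fortysix, x, y, hx, hy, h6, Or.inr (Or.inr (Or.inr (Or.inr (Or.inr (Or.inr (Or.inl ⟨rfl, rfl⟩))))))⟩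
    · exact ⟨10, 23, rep6_dvd_eval_csPoly_fortysix, x, y, hx, hy, h7, Or.inr (Or.inr (Or.inr (Or.inr (Or.inr (Or.inr (Or.inr (Or.inl ⟨rfl, rfl⟩)))))))⟩
    · exact ⟨4, 17, rep7_dvd_eval_csPoly_fortysix, x, y, hx, hy, h8, Or.inr (Or.inr (Or.inr (Or.inr (Or.inr (Or.inr (Or.inr (Or.inr (Or.inl ⟨rfl, rfl⟩))))))))⟩
    · exact ⟨30, 31, rep8_dvd_eval_csPoly_fortysix, x, y, hx, hy, h9, Or.inr (Or.inr (Or.inr (Or.inr (Or.inr (Or.inr (Or.inr (Or.inr (Or.inr (Or.inl ⟨rfl, rfl⟩)))))))))⟩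
    · exact ⟨3, 23, rep9_dvd_eval_csPoly_fortysix, x, y, hx, hy, h10, Or.inr (Or.inr (Or.inr (Or.inr (Or.inr (Or.inr (Or.inr (Or.inr (Or.inr (Or.inr (Or.inl ⟨rfl, rfl⟩))))))))))⟩
    · exact ⟨38, 51, rep10_dvd_eval_csPoly_fortysix, x, y, hx, hy, h11, Or.inr (Or.inr (Or.inr (Or.inr (Or.inr (Or.inr (Or.inr (Or.inr (Or.inr (Or.inr (Or.inr (⟨rfl, rfl⟩)))))))))))⟩
  obtain ⟨c, d, h, hconj, hcd⟩ := exists_isConj_standardCSMatrix_of_cover _ hcover A hdet htr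
  rcases hcd with ⟨rfl, rfl⟩ | ⟨rfl, rfl⟩ | ⟨rfl, rfl⟩ | ⟨rfl, rfl⟩ | ⟨rfl, rfl⟩ | ⟨rfl, rfl⟩ | ⟨rfl, rfl⟩ | ⟨rfl, rfl⟩ | ⟨rfl, rfl⟩ | ⟨rfl, rfl⟩ | ⟨rfl, rfl⟩ | ⟨rfl, rfl⟩
  · exact Or.inl hconj
  · exact Or.inr (Or.inl hconj)
  · exact Or.inr (Or.inr (Or.inl hconj))
  · exact Or.inr (Or.inr (Or.inr (Or.inl hconj)))
  · exact Or.inr (Or.inr (Or.inr (Or.inr (Or.inl hconj))))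
  · exact Or.inr (Or.inr (Or.inr (Or.inr (Or.inr (Or.inl hconj)))))
  · exact Or.inr (Or.inr (Or.inr (Or.inr (Or.inr (Or.inr (Or.inl hconj))))))
  · exact Or.inr (Or.inr (Or.inr (Or.inr (Or.inr (Or.inr (Or.inr (Or.inl hconj)))))))
  · exact Or.inr (Or.inr (Or.inr (Or.inr (Or.inr (Or.inr (Or.inr (Or.inr (Or.inl hconj))))))))
  · exact Or.inr (Or.inr (Or.inr (Or.inr (Or.inr (Or.inr (Or.inr (Or.inr (Or.inr (Or.inl hconj)))))))))
  · exact Or.inr (Or.inr (Or.inr (Or.inr (Or.inr (Or.inr (Or.inr (Or.inr (Or.inr (Or.inr (Or.inl hconj))))))))))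
  · exact Or.inr (Or.inr (Or.inr (Or.inr (Or.inr (Or.inr (Or.inr (Or.inr (Or.inr (Or.inr (Or.inr (hconj)))))))))))

/-- **Kim–Yamada 2023, Theorem B for the trace `46`, PROVED (inductive step of Lemma 6.1: granted the conjecture for the smaller traces named as hypotheses)**: the non-trivial classes move by
Gompf moves to the traces `8` (from `(14, 19, 46)`), `2` (from `(3, 11, 46)`), `1` (from `(2, 3, 46)`), `-12` (from `(4, 29, 46)`), `-21` (from `(48, 67, 46)`), `1` (from `(5, 9, 46)`), `0` (from `(10, 23, 46)`), `-5` (from `(4, 17, 46)`), `15` (from `(30, 31, 46)`), `0` (from `(3, 23, 46)`), `-5` (from `(38, 51, 46)`), where Gompf's conjecture holds or is assumed. [cite: KimYamada2023, Thm. B, Lemma 6.1 and §6.1] -/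
theorem gompfConjectureForTrace_fortysix_of
    (hneg21 : GompfConjectureForTrace (-21))
    (hneg12 : GompfConjectureForTrace (-12)) : GompfConjectureForTrace 46 := by
  intro A hdet htr
  rcases isConj_standardCSMatrix_of_trace_eq_fortysix A hdet htr with h0 | h1 | h2 | h3 | h4 | h5 | h6 | h7 | h8 | h9 | h10 | h11
  · exact (GompfEquiv.of_isConj h0).trans (gompfEquiv_standardCSMatrix_one_one 44 (one_dvd _))
  · exact (GompfEquiv.of_isConj h1).trans
      (gompfEquiv_standardCSMatrix_akbulutKirbyMatrix_of_modEq
        (gompfConjectureForTrace_of_mem_Icc_neg_seven_twelve (by norm_num)) rep0_dvd_eval_csPoly_fortysix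
        (show (46 : ℤ) ≡ 8 [ZMOD 19] by decide))
  · exact (GompfEquiv.of_isConj h2).trans
      (gompfEquiv_standardCSMatrix_akbulutKirbyMatrix_of_modEq
        (gompfConjectureForTrace_of_mem_Icc_neg_seven_twelve (by norm_num)) rep1_dvd_eval_csPoly_fortysix
        (show (46 : ℤ) ≡ 2 [ZMOD 11] by decide))
  · exact (GompfEquiv.of_isConj h3).trans
      (gompfEquiv_standardCSMatrix_akbulutKirbyMatrix_of_modEq
        (gompfConjectureForTrace_of_mem_Icc_neg_seven_twelve (by norm_num)) rep2_dvd_eval_csPoly_fortysix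
        (show (46 : ℤ) ≡ 1 [ZMOD 3] by decide))
  · exact (GompfEquiv.of_isConj h4).trans
      (gompfEquiv_standardCSMatrix_akbulutKirbyMatrix_of_modEq
        hneg12 rep3_dvd_eval_csPoly_fortysix
        (show (46 : ℤ) ≡ -12 [ZMOD 29] by decide))
  · exact (GompfEquiv.of_isConj h5).trans
      (gompfEquiv_standardCSMatrix_akbulutKirbyMatrix_of_modEq
        hneg21 rep4_dvd_eval_csPoly_fortysix
        (show (46 : ℤ) ≡ -21 [ZMOD 67] by decide))
  · exact (GompfEquiv.of_isConj h6).trans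
      (gompfEquiv_standardCSMatrix_akbulutKirbyMatrix_of_modEq
        (gompfConjectureForTrace_of_mem_Icc_neg_seven_twelve (by norm_num)) rep5_dvd_eval_csPoly_fortysix
        (show (46 : ℤ) ≡ 1 [ZMOD 9] by decide))
  · exact (GompfEquiv.of_isConj h7).trans
      (gompfEquiv_standardCSMatrix_akbulutKirbyMatrix_of_modEq
        (gompfConjectureForTrace_of_mem_Icc_neg_seven_twelve (by norm_num)) rep6_dvd_eval_csPoly_fortysix
        (show (46 : ℤ) ≡ 0 [ZMOD 23] by decide))
  · exact (GompfEquiv.of_isConj h8).trans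
      (gompfEquiv_standardCSMatrix_akbulutKirbyMatrix_of_modEq
        (gompfConjectureForTrace_of_mem_Icc_neg_seven_twelve (by norm_num)) rep7_dvd_eval_csPoly_fortysix
        (show (46 : ℤ) ≡ -5 [ZMOD 17] by decide))
  · exact (GompfEquiv.of_isConj h9).trans
      (gompfEquiv_standardCSMatrix_akbulutKirbyMatrix_of_modEq
        gompfConjectureForTrace_fifteen rep8_dvd_eval_csPoly_fortysix
        (show (46 : ℤ) ≡ 15 [ZMOD 31] by decide))
  · exact (GompfEquiv.of_isConj h10).trans
      (gompfEquiv_standardCSMatrix_akbulutKirbyMatrix_of_modEq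
        (gompfConjectureForTrace_of_mem_Icc_neg_seven_twelve (by norm_num)) rep9_dvd_eval_csPoly_fortysix
        (show (46 : ℤ) ≡ 0 [ZMOD 23] by decide))
  · exact (GompfEquiv.of_isConj h11).trans
      (gompfEquiv_standardCSMatrix_akbulutKirbyMatrix_of_modEq
        (gompfConjectureForTrace_of_mem_Icc_neg_seven_twelve (by norm_num)) rep10_dvd_eval_csPoly_fortysix
        (show (46 : ℤ) ≡ -5 [ZMOD 51] by decide))

/-- **Theorem B for the trace `-41`** (`= 5 - 46`), by Theorem A (under the same hypotheses). [cite: KimYamada2023, Thm. A and Thm. B] -/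
theorem gompfConjectureForTrace_neg_fortyone_of
    (hneg21 : GompfConjectureForTrace (-21))
    (hneg12 : GompfConjectureForTrace (-12)) : GompfConjectureForTrace (-41) := by
  have h := gompfConjectureForTrace_of_five_sub (gompfConjectureForTrace_fortysix_of hneg21 hneg12)
  norm_num at h
  exact h

end Matrices


end Literature.Topology.FourManifolds

end
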